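import Literature.NumberTheory.LFunctions.YoshidaWindowGramTailJFactored
import HarnessLib

/-!
# Kernel enclosures of Yoshida's matrix coefficients — VII-f: TIGHT boxes of the order-`J` tail diagonals `dg⁺`, `dg⁻`

Source: H. Yoshida, Adv. Stud. Pure Math. **21** (1992) 281–325, §§5–7 [Yoshida1992HermitianForms]; R. E. Moore,
*Interval Analysis* (1966), Ch. 3 [Moore1966] (inclusion property).

`Encl.dgJeBox` (part VII-d) boxes `dg⁺(i) = (1+θ⁻¹)·(B/(d₀(4J+1)(B₃−1)^{4J+1}))·ρ_i²` by first forming the tiny constant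
`(1+θ⁻¹)B/(d₀(4J+1)(B₃−1)^{4J+1})` as a fixed-point interval and then multiplying by `ρ_i²`: at production sizes
(`B₃ = 512`, `J = 4`: `(B₃−1)^{17} ≈ 10^{46}`) that constant is below `2^{−140}` and the box keeps only a few bits, so the
product is `≈ 10^{−9}` wide — more than the head pivots `≈ 3.5·10^{−8}/n` of Yoshida's matrix tolerate (measured by
rh-explicit weil-2, 2026-08-22).  The boxes below multiply FIRST (`ρ_i² · (θn+θd)·B·2^{cd}`, a large exact integer multiple)
and divide LAST, so the only rounding is the final `1/S`:

* `Encl.dgJeBoxT`, `Encl.mem_dgJeBoxT` (even); `Encl.dgJoBoxT`, `Encl.mem_dgJoBoxT` (odd) — same real values `dgJe`/`dgJo`.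

Everything is proved; no named facts.
-/

open Real Complex Finset Matrix
open scoped BigOperators

namespace Literature.NumberTheory.LFunctions.Yoshida1992

open Literature.Analysis.SpecialFunctions Literature.Analysis.ValidatedNumerics.NumericsMP
open Literature.Analysis.ValidatedNumerics

namespace Encl

variable {S : ℕ} {a : ℝ} {ks : List PrimeLen} {C : Consts}

/-- Tight box of `dg⁺(i)`: `(ρ_i² · ((θn+θd)·B·2^{cd})) / (θn·d0z·(4J+1)·(B₃−1)^{4J+1})`, division last.
[cite: Moore1966, Ch. 3 (interval arithmetic: inclusion property)] -/
def dgJeBoxT (S : ℕ) (C : Consts) (F : FDConsts) (R : IdxRec) (cd d0z Be B3e Je θn θd : ℕ) (i : ℕ) : MI :=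
  (((rhoEBox S C F R Je i).sqr S).mulInt (((θn + θd) * Be * 2 ^ cd : ℕ) : ℤ)).divNat
    (θn * d0z * (4 * Je + 1) * (B3e - 1) ^ (4 * Je + 1))

/-- [cite: Moore1966, Ch. 3 (interval arithmetic: inclusion property)] -/
theorem mem_dgJeBoxT (hS : 0 < S) (hC : ConstsValid S a ks C) {F : FDConsts} (hF : FDValid S a F)
    {cd d0z Be B3e Je θn θd : ℕ} (hd0 : 0 < d0z) (hθn : 0 < θn) (hθd : 0 < θd) (hB3 : 2 ≤ B3e) {i : ℕ} {R : IdxRec}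
    (hR : OffValid S a ks (i : ℤ) R) :
    MI.mem S (dgJe a ((θn : ℝ) / θd) ((d0z : ℝ) * (1 / 2 ^ cd)) Be B3e Je i)
      (dgJeBoxT S C F R cd d0z Be B3e Je θn θd i) := by
  have hX : 0 < B3e - 1 := by omega
  have hθd' : (θd : ℝ) ≠ 0 := by exact_mod_cast hθd.ne'
  have hθn' : (θn : ℝ) ≠ 0 := by exact_mod_cast hθn.ne'
  have hd0' : (d0z : ℝ) ≠ 0 := by exact_mod_cast hd0.ne'
  have h2 : (2 : ℝ) ^ cd ≠ 0 := by positivity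
  have hX' : (((B3e - 1 : ℕ) : ℝ)) ≠ 0 := by exact_mod_cast hX.ne'
  have h := MI.mem_divNat (MI.mem_mulInt (MI.mem_sqr hS (mem_rhoEBox hS hC hF (Je := Je) hR))
    (((θn + θd) * Be * 2 ^ cd : ℕ) : ℤ)) (n := θn * d0z * (4 * Je + 1) * (B3e - 1) ^ (4 * Je + 1)) (by positivity)
  unfold dgJeBoxT
  refine mem_of_eq h ?_
  unfold dgJe
  push_cast
  field_simp

/-- Tight box of `dg⁻(k)` (odd; record of mode `k + 1`). [cite: Moore1966, Ch. 3 (interval arithmetic: inclusion property)] -/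
def dgJoBoxT (S : ℕ) (C : Consts) (F : FDConsts) (R : IdxRec) (cd d0z Bo B3o Jo θn θd : ℕ) (k : ℕ) : MI :=
  (((rhoOBox S C F R Jo k).sqr S).mulInt (((θn + θd) * Bo * 2 ^ cd : ℕ) : ℤ)).divNat
    (θn * d0z * (4 * Jo + 1) * B3o ^ (4 * Jo + 1))

/-- [cite: Moore1966, Ch. 3 (interval arithmetic: inclusion property)] -/
theorem mem_dgJoBoxT (hS : 0 < S) (hC : ConstsValid S a ks C) {F : FDConsts} (hF : FDValid S a F)
    {cd d0z Bo B3o Jo θn θd : ℕ} (hd0 : 0 < d0z) (hθn : 0 < θn) (hθd : 0 < θd) (hB3 : 1 ≤ B3o) {k : ℕ} {R : IdxRec}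
    (hR : OffValid S a ks ((k : ℤ) + 1) R) :
    MI.mem S (dgJo a ((θn : ℝ) / θd) ((d0z : ℝ) * (1 / 2 ^ cd)) Bo B3o Jo k)
      (dgJoBoxT S C F R cd d0z Bo B3o Jo θn θd k) := by
  have hθd' : (θd : ℝ) ≠ 0 := by exact_mod_cast hθd.ne'
  have hθn' : (θn : ℝ) ≠ 0 := by exact_mod_cast hθn.ne'
  have hd0' : (d0z : ℝ) ≠ 0 := by exact_mod_cast hd0.ne'
  have h2 : (2 : ℝ) ^ cd ≠ 0 := by positivity
  have hX' : ((B3o : ℕ) : ℝ) ≠ 0 := by exact_mod_cast (show 0 < B3o by omega).ne'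
  have h := MI.mem_divNat (MI.mem_mulInt (MI.mem_sqr hS (mem_rhoOBox hS hC hF (Jo := Jo) hR))
    (((θn + θd) * Bo * 2 ^ cd : ℕ) : ℤ)) (n := θn * d0z * (4 * Jo + 1) * B3o ^ (4 * Jo + 1)) (by positivity)
  unfold dgJoBoxT
  refine mem_of_eq h ?_
  unfold dgJo
  push_cast
  field_simp

end Encl

end Literature.NumberTheory.LFunctions.Yoshida1992
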